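import Summits.AtomisticToContinuum.FouriersLaw.Theorems.BondHeatUncertaintyExtensiveSnapshotIrreversibilityEnergyWindowSkeletonVariation
import Summits.AtomisticToContinuum.FouriersLaw.Theorems.BondHeatUncertaintyExtensiveSnapshotIrreversibilityEnergyWindowFlowJacobianMoment

/-!
# Energy window, part T-a (file 2 of 2) — moments of the skeleton-direction Jacobians: (JMˣ)₁ PROVED

Lineage `stmt-AtomisticToContinuum-9121` (`ExtensiveSnapshotIrreversibility`), K_fix half, leaf S3
`KernelTemperatureLipschitz`; record S3 ⟸ (Dˢ) ∧ (G1ℓ) ∧ (G1*ᶜᶜ) [Rᵇ], (G1ℓ) ⟸ (SWM) ∧ (JM),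
(G1*ᶜᶜ) ⟸ (SWM) (glue parts S–V).  Cell decomp-a2c, lens «grading / quantitative ladder», generation 79,
part T «SkeletonIdentities» (critic rows 1077 (d), 1086 (c), 1093 (g)) = five files: T-a
`…SkeletonVariation` (§1–§3, §6) → `…SkeletonJacobianMoments` (§4–§5) and T-b `…SkeletonCoordinates`
(§1–§3) → `…SkeletonRegularity` (§4) → `…SkeletonIdentities` (§5–§6); section numbers refer to the
part (T-a resp. T-b) as a whole.

THIS FILE (T-a §4–§5).  From file 1's pathwise bound
`‖D_x X_s^{m}(z,r,x)[δ]‖ ≤ max(|c_L|,|c_R|)·skelAbsSum δ·exp ∫₀ˢ (A₀ + A₁√H(X_u)) du` (§3) to moments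
along the Brownian path `(x, r) = (Ξ_m(B), R_m(B))`:
* §4 `lintegral_rpow_le_of_le_mul_exp_integral` — S′b's moment mechanism ABSTRACTED: any `F ≥ 0` with
  `F ≤ M·exp(∫₀ˢ (a₀ + a₁√H(Φ_u(z,B))) du)` pathwise has
  `E F^q ≤ M^q exp(q a₀ + q²a₁²/(4θ) + θγ(T_L+T_R)) e^{θH(z)}` for `0 < θ < 1/max(T_L,T_R)`, `q ≥ 1`
  (Young `q a₁√h ≤ θh + q²a₁²/(4θ)`, Jensen in time, Tonelli, the exponential-moment bound CEHR (3.4));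
  no measurability of `F` is needed (upper integrals); `lintegral_rpow_norm_fderiv_skelFlowMapAt_le` is
  the explicit `θ`-form for the skeleton Jacobians, any temperatures.
* §5 **(JMˣ)₁ `SkeletonJacobianMoments`** — PROVED (`skeletonJacobianMoments`): for every `q ≥ 1`,
  `ε > 0` a constant `C` (uniform over the temperature window `[T/2, 2T]²`, over `s ∈ [0,1]`, the LEVEL
  `m`, the starting point and the direction) with `E ‖D_Ξ X_s^{m}[δ]‖^q ≤ (C · skelAbsSum δ · e^{εH(z)})^q`
  (`θ = min ε (1/(4T))`, `C = √(4γT)·exp(A₀ + qA₁²/(4θ) + 4θγT)`).  So every column of the skeleton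
  Jacobian `J` has all moments, uniformly in the level and the index — the first of the two
  integrability inputs of T-b's identities; the second is file 1's leaf (JMˣ)₂.
No instance / notation / option; no proof holes.
References: N. Cuneo, J.-P. Eckmann, M. Hairer, L. Rey-Bellet, Electron. J. Probab. 23 (2018), §3
eq. (3.4) [cite: CuneoEckmannHairerReyBellet2018, §3 eq. (3.4)]; D. Nualart, The Malliavin Calculus and
Related Topics (2006), §2.2 (the shape `D_h X_t = ∫ J_{t,u} σ ḣ(u) du`). [folklore]
-/

noncomputable section

namespace Summit.AtomisticToContinuum.FouriersLaw.Theorems.ExtensiveSnapshotIrreversibility.EnergyWindow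

open MeasureTheory Filter Topology Real unitInterval Set
open scoped ENNReal NNReal ContDiff
open Literature.MathematicalPhysics.KineticTheory.HeatConduction
open Literature.Probability.Process Literature.Analysis.ODE

/-! ## 4. The moment mechanism of S′b, abstracted -/

section Moment

variable {ω₂ lam β γ : ℝ} (hω : 0 < ω₂) (hl : 0 ≤ lam) (hβ : 0 ≤ β) (hγ : 0 ≤ γ) {N : ℕ}
  (hN : 0 < N) {T_L T_R : ℝ} (hTL : 0 < T_L) (hTR : 0 < T_R)

include hω hl hβ hγ hN hTL hTR in
/-- **Moments of functionals dominated by `exp ∫ (a₀ + a₁√H)` along the flow.** For `q ≥ 1`,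
`0 < θ < 1/max(T_L, T_R)`, `s ∈ [0, 1]`, `a₀, M ≥ 0`, any `a₁`, and any `F ≥ 0` on path space with
`F(B) ≤ M · exp(∫₀ˢ (a₀ + a₁ √H(Φ_u(z, B))) du)` for every path:
`E F^q ≤ M^q · exp(q a₀ + q² a₁²/(4θ) + θγ(T_L+T_R)) · exp(θ H(z))`
(Young `q a₁ √h ≤ θ h + q²a₁²/(4θ)`, Jensen in time, Tonelli, and the fixed-time exponential
moment CEHR (3.4) along the flow; the upper integral needs no measurability of `F`).
[cite: CuneoEckmannHairerReyBellet2018, §3 eq. (3.4)] -/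
theorem lintegral_rpow_le_of_le_mul_exp_integral {q : ℝ} (hq : 1 ≤ q) {θ : ℝ} (hθ : 0 < θ)
    (hθ' : θ < 1 / max T_L T_R) {s : ℝ} (hs : s ∈ Icc (0 : ℝ) 1) (z : PhaseSpace N)
    {a₀ a₁ M : ℝ} (ha₀ : 0 ≤ a₀) (hM : 0 ≤ M) {F : WienerPair → ℝ}
    (hF0 : ∀ wp, 0 ≤ F wp)
    (hF : ∀ wp, F wp ≤ M * Real.exp (∫ u in (0 : ℝ)..s, (a₀ + a₁ *
      √((pinnedChain ω₂ lam β γ).hamiltonian N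
        ((pinnedChain ω₂ lam β γ).solMap N T_L T_R u z (pairPath wp)))))) :
    ∫⁻ wp, ENNReal.ofReal (F wp) ^ q ∂wienerPair ≤
      ENNReal.ofReal (M ^ q * (Real.exp (q * a₀ + q ^ 2 * a₁ ^ 2 / (4 * θ) +
          θ * γ * (T_L + T_R)) * Real.exp (θ * (pinnedChain ω₂ lam β γ).hamiltonian N z))) := by
  have hq0 : 0 ≤ q := zero_le_one.trans hq
  have hMq : 0 ≤ M ^ q := Real.rpow_nonneg hM q
  have hHz : 0 ≤ (pinnedChain ω₂ lam β γ).hamiltonian N z :=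
    pinnedChain_hamiltonian_nonneg hω.le hl hβ γ N z
  set K₁ := q * a₀ + q ^ 2 * a₁ ^ 2 / (4 * θ) with hK₁
  have hK₁0 : 0 ≤ K₁ := by rw [hK₁]; positivity
  clear_value K₁
  have hγT : 0 ≤ θ * γ * (T_L + T_R) := by positivity
  -- the energy along the path
  set h : WienerPair → ℝ → ℝ := fun wp u =>
    (pinnedChain ω₂ lam β γ).hamiltonian N
      ((pinnedChain ω₂ lam β γ).solMap N T_L T_R u z (pairPath wp)) with hh_def
  have hh0 : ∀ wp u, 0 ≤ h wp u := fun wp u => pinnedChain_hamiltonian_nonneg hω.le hl hβ γ N _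
  have hhc : ∀ wp, Continuous (h wp) := fun wp =>
    (pinnedChain_continuous_hamiltonian ω₂ lam β γ N).comp
      (pinnedChain_continuous_solMap hω hl hβ hγ N T_L T_R z (pairPath wp))
  have hhm : ∀ u, Measurable fun wp => h wp u := fun u =>
    (pinnedChain_continuous_hamiltonian ω₂ lam β γ N).measurable.comp
      (pinnedChain_measurable_solMap_pairPath_right hω hl hβ hγ N T_L T_R u z)
  -- Step 1 (pathwise): `F^q ≤ M^q e^{K₁} exp(θ ∫₀ˢ h)`
  have step1 : ∀ wp, F wp ^ q ≤
      M ^ q * Real.exp K₁ * Real.exp (θ * ∫ u in (0 : ℝ)..s, h wp u) := by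
    intro wp
    set I₁ := ∫ u in (0 : ℝ)..s, (a₀ + a₁ * √(h wp u)) with hI
    have h1 : F wp ^ q ≤ M ^ q * Real.exp (q * I₁) := by
      have h0 := Real.rpow_le_rpow (hF0 wp) (hF wp) hq0
      rw [Real.mul_rpow hM (Real.exp_pos _).le, ← Real.exp_mul, mul_comm I₁ q] at h0
      exact h0
    have hI' : q * I₁ = ∫ u in (0 : ℝ)..s, (q * a₀ + q * a₁ * √(h wp u)) := by
      rw [hI, ← intervalIntegral.integral_const_mul]
      refine intervalIntegral.integral_congr fun u _ => ?_
      ring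
    have hmono : ∫ u in (0 : ℝ)..s, (q * a₀ + q * a₁ * √(h wp u)) ≤
        ∫ u in (0 : ℝ)..s, (K₁ + θ * h wp u) := by
      refine intervalIntegral.integral_mono_on hs.1 ?_ ?_ fun u _ => ?_
      · exact (continuous_const.add (continuous_const.mul (hhc wp).sqrt)).intervalIntegrable _ _
      · exact (continuous_const.add (continuous_const.mul (hhc wp))).intervalIntegrable _ _
      · have hy := mul_sqrt_le_young (c := q * a₁) (hh0 wp u) hθ
        have he : (q * a₁) ^ 2 / (4 * θ) = q ^ 2 * a₁ ^ 2 / (4 * θ) := by ring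
        rw [hK₁]; linarith
    have i3 : IntervalIntegrable (fun u => θ * h wp u) volume 0 s :=
      (continuous_const.mul (hhc wp)).intervalIntegrable _ _
    have hconst : ∫ u in (0 : ℝ)..s, (K₁ + θ * h wp u) =
        s * K₁ + θ * ∫ u in (0 : ℝ)..s, h wp u := by
      rw [intervalIntegral.integral_add intervalIntegrable_const i3,
        intervalIntegral.integral_const, intervalIntegral.integral_const_mul, sub_zero, smul_eq_mul]
    have hsK : s * K₁ ≤ K₁ := mul_le_of_le_one_left hK₁0 hs.2
    have h2 : q * I₁ ≤ K₁ + θ * ∫ u in (0 : ℝ)..s, h wp u := by linarith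
    calc F wp ^ q ≤ M ^ q * Real.exp (q * I₁) := h1
      _ ≤ M ^ q * Real.exp (K₁ + θ * ∫ u in (0 : ℝ)..s, h wp u) :=
          mul_le_mul_of_nonneg_left (Real.exp_le_exp.2 h2) hMq
      _ = M ^ q * Real.exp K₁ * Real.exp (θ * ∫ u in (0 : ℝ)..s, h wp u) := by
          rw [Real.exp_add, mul_assoc]
  -- the right-hand side dominates `M^q e^{K₁}`
  have hRHS : M ^ q * Real.exp K₁ ≤ M ^ q * (Real.exp (K₁ + θ * γ * (T_L + T_R)) *
      Real.exp (θ * (pinnedChain ω₂ lam β γ).hamiltonian N z)) := by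
    refine mul_le_mul_of_nonneg_left ?_ hMq
    calc Real.exp K₁ = Real.exp K₁ * 1 := (mul_one _).symm
      _ ≤ Real.exp (K₁ + θ * γ * (T_L + T_R)) *
          Real.exp (θ * (pinnedChain ω₂ lam β γ).hamiltonian N z) :=
        mul_le_mul (Real.exp_le_exp.2 (by linarith)) (Real.one_le_exp (by positivity))
          zero_le_one (Real.exp_pos _).le
  rcases hs.1.eq_or_lt with hs0 | hs0
  · -- `s = 0`
    have hb : ∀ wp, F wp ^ q ≤ M ^ q * Real.exp K₁ := fun wp => by
      have h1 := step1 wp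
      rw [← hs0, intervalIntegral.integral_same, mul_zero, Real.exp_zero, mul_one] at h1
      exact h1
    calc ∫⁻ wp, ENNReal.ofReal (F wp) ^ q ∂wienerPair
        ≤ ∫⁻ _wp, ENNReal.ofReal (M ^ q * Real.exp K₁) ∂wienerPair :=
          lintegral_mono fun wp => by
            rw [ENNReal.ofReal_rpow_of_nonneg (hF0 wp) hq0]
            exact ENNReal.ofReal_le_ofReal (hb wp)
      _ = ENNReal.ofReal (M ^ q * Real.exp K₁) := by rw [lintegral_const, measure_univ, mul_one]
      _ ≤ _ := ENNReal.ofReal_le_ofReal hRHS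
  · -- `0 < s ≤ 1`
    -- Step 2 (pathwise Jensen): `F^q ≤ M^q e^{K₁} s⁻¹ ∫₀ˢ exp(θ h)`
    have bound : ∀ wp, F wp ^ q ≤
        M ^ q * Real.exp K₁ * s⁻¹ * ∫ u in (0 : ℝ)..s, Real.exp (θ * h wp u) := by
      intro wp
      have hI0 : 0 ≤ ∫ u in (0 : ℝ)..s, h wp u :=
        intervalIntegral.integral_nonneg hs.1 fun u _ => hh0 wp u
      have hθI : 0 ≤ θ * ∫ u in (0 : ℝ)..s, h wp u := mul_nonneg hθ.le hI0
      have hcf : Continuous fun u => θ * h wp u := continuous_const.mul (hhc wp)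
      have hjen := mul_exp_div_le_integral_exp hcf hs0
      rw [intervalIntegral.integral_const_mul] at hjen
      have hm : θ * ∫ u in (0 : ℝ)..s, h wp u ≤ (θ * ∫ u in (0 : ℝ)..s, h wp u) / s := by
        rw [le_div_iff₀ hs0]; exact mul_le_of_le_one_right hθI hs.2
      have hexp : Real.exp (θ * ∫ u in (0 : ℝ)..s, h wp u) ≤
          s⁻¹ * ∫ u in (0 : ℝ)..s, Real.exp (θ * h wp u) := by
        rw [le_inv_mul_iff₀ hs0]
        calc s * Real.exp (θ * ∫ u in (0 : ℝ)..s, h wp u)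
            ≤ s * Real.exp ((θ * ∫ u in (0 : ℝ)..s, h wp u) / s) :=
              mul_le_mul_of_nonneg_left (Real.exp_le_exp.2 hm) hs0.le
          _ ≤ ∫ u in (0 : ℝ)..s, Real.exp (θ * h wp u) := hjen
      have hK0 : 0 ≤ M ^ q * Real.exp K₁ := mul_nonneg hMq (Real.exp_pos _).le
      calc F wp ^ q ≤ M ^ q * Real.exp K₁ * Real.exp (θ * ∫ u in (0 : ℝ)..s, h wp u) := step1 wp
        _ ≤ M ^ q * Real.exp K₁ * (s⁻¹ * ∫ u in (0 : ℝ)..s, Real.exp (θ * h wp u)) :=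
            mul_le_mul_of_nonneg_left hexp hK0
        _ = M ^ q * Real.exp K₁ * s⁻¹ * ∫ u in (0 : ℝ)..s, Real.exp (θ * h wp u) :=
            (mul_assoc _ _ _).symm
    -- Step 3: joint measurability of `(wp, u) ↦ exp(θ h)`
    have hG_meas : Measurable (Function.uncurry fun (u : ℝ) (wp : WienerPair) =>
        ENNReal.ofReal (Real.exp (θ * h wp u))) := by
      have hc : ∀ wp : WienerPair,
          Continuous fun u : ℝ => ENNReal.ofReal (Real.exp (θ * h wp u)) := fun wp => by
        have h1 : Continuous fun u : ℝ => θ * h wp u := continuous_const.mul (hhc wp)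
        exact ENNReal.continuous_ofReal.comp h1.rexp
      have hm : ∀ u : ℝ,
          Measurable fun wp : WienerPair => ENNReal.ofReal (Real.exp (θ * h wp u)) := fun u => by
        have h1 : Measurable fun wp : WienerPair => θ * h wp u := measurable_const.mul (hhm u)
        exact ENNReal.measurable_ofReal.comp h1.exp
      exact measurable_uncurry_of_continuous_of_measurable hc hm
    have hswap : ∫⁻ wp, (∫⁻ u in Ioc 0 s, ENNReal.ofReal (Real.exp (θ * h wp u))) ∂wienerPair =
        ∫⁻ u in Ioc 0 s, (∫⁻ wp, ENNReal.ofReal (Real.exp (θ * h wp u)) ∂wienerPair) :=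
      (lintegral_lintegral_swap (μ := volume.restrict (Ioc 0 s)) (ν := wienerPair)
        hG_meas.aemeasurable).symm
    -- Step 4: the inner time integral as a Lebesgue integral
    have hGc : ∀ wp, Continuous fun u => Real.exp (θ * h wp u) := fun wp => by
      have h1 : Continuous fun u : ℝ => θ * h wp u := continuous_const.mul (hhc wp)
      exact h1.rexp
    have hinner : ∀ wp, ENNReal.ofReal (∫ u in (0 : ℝ)..s, Real.exp (θ * h wp u)) =
        ∫⁻ u in Ioc 0 s, ENNReal.ofReal (Real.exp (θ * h wp u)) := fun wp => by
      rw [intervalIntegral.integral_of_le hs.1]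
      exact ofReal_integral_eq_lintegral_ofReal
        ((hGc wp).integrableOn_Icc.mono_set Ioc_subset_Icc_self)
        (ae_of_all _ fun u => (Real.exp_pos _).le)
    -- Step 5: CEHR fixed-time exponential moment along the flow, uniformly on `(0, s]`
    have hce : ∀ u ∈ Ioc (0 : ℝ) s,
        ∫⁻ wp, ENNReal.ofReal (Real.exp (θ * h wp u)) ∂wienerPair ≤
          ENNReal.ofReal (Real.exp (θ * γ * (T_L + T_R)) *
            Real.exp (θ * (pinnedChain ω₂ lam β γ).hamiltonian N z)) := by
      intro u hu
      have h34 := pinnedChain_lintegral_exp_hamiltonian_solMap_le hω hl hβ hγ hN hTL hTR hθ hθ'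
        u.toNNReal z
      rw [Real.coe_toNNReal u hu.1.le] at h34
      refine h34.trans (ENNReal.ofReal_le_ofReal
        (mul_le_mul_of_nonneg_right (Real.exp_le_exp.2 ?_) (Real.exp_pos _).le))
      have hu1 : u ≤ 1 := hu.2.trans hs.2
      exact mul_le_of_le_one_right hγT hu1
    -- Step 6: integrate, swap (Tonelli), bound
    have hK0' : 0 ≤ M ^ q * Real.exp K₁ * s⁻¹ :=
      mul_nonneg (mul_nonneg hMq (Real.exp_pos _).le) (inv_nonneg.2 hs0.le)
    calc ∫⁻ wp, ENNReal.ofReal (F wp) ^ q ∂wienerPair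
        ≤ ∫⁻ wp, ENNReal.ofReal (M ^ q * Real.exp K₁ * s⁻¹) *
            ENNReal.ofReal (∫ u in (0 : ℝ)..s, Real.exp (θ * h wp u)) ∂wienerPair := by
          refine lintegral_mono fun wp => ?_
          rw [ENNReal.ofReal_rpow_of_nonneg (hF0 wp) hq0, ← ENNReal.ofReal_mul hK0']
          exact ENNReal.ofReal_le_ofReal (bound wp)
      _ = ENNReal.ofReal (M ^ q * Real.exp K₁ * s⁻¹) *
            ∫⁻ wp, (∫⁻ u in Ioc 0 s, ENNReal.ofReal (Real.exp (θ * h wp u))) ∂wienerPair := by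
          rw [lintegral_const_mul' _ _ ENNReal.ofReal_ne_top]
          congr 1
          exact lintegral_congr fun wp => hinner wp
      _ = ENNReal.ofReal (M ^ q * Real.exp K₁ * s⁻¹) *
            ∫⁻ u in Ioc 0 s, (∫⁻ wp, ENNReal.ofReal (Real.exp (θ * h wp u)) ∂wienerPair) := by
          rw [hswap]
      _ ≤ ENNReal.ofReal (M ^ q * Real.exp K₁ * s⁻¹) *
            ∫⁻ _u in Ioc 0 s, ENNReal.ofReal (Real.exp (θ * γ * (T_L + T_R)) *
              Real.exp (θ * (pinnedChain ω₂ lam β γ).hamiltonian N z)) :=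
          mul_le_mul' le_rfl (setLIntegral_mono measurable_const hce)
      _ = ENNReal.ofReal (M ^ q * Real.exp K₁ * s⁻¹) *
            (ENNReal.ofReal (Real.exp (θ * γ * (T_L + T_R)) *
              Real.exp (θ * (pinnedChain ω₂ lam β γ).hamiltonian N z)) * ENNReal.ofReal s) := by
          rw [setLIntegral_const, Real.volume_Ioc, sub_zero]
      _ = ENNReal.ofReal (M ^ q * (Real.exp (K₁ + θ * γ * (T_L + T_R)) *
            Real.exp (θ * (pinnedChain ω₂ lam β γ).hamiltonian N z))) := by
          rw [← ENNReal.ofReal_mul (by positivity), ← ENNReal.ofReal_mul hK0']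
          congr 1
          rw [Real.exp_add]
          calc M ^ q * Real.exp K₁ * s⁻¹ * (Real.exp (θ * γ * (T_L + T_R)) *
                Real.exp (θ * (pinnedChain ω₂ lam β γ).hamiltonian N z) * s)
              = M ^ q * (Real.exp K₁ * Real.exp (θ * γ * (T_L + T_R)) *
                Real.exp (θ * (pinnedChain ω₂ lam β γ).hamiltonian N z)) * (s⁻¹ * s) := by ring
            _ = _ := by rw [inv_mul_cancel₀ hs0.ne', mul_one]

include hω hl hβ hγ hN hTL hTR in
/-- **`q`-th moment of the skeleton-direction Jacobian along the Brownian path, controlled by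
`e^{θH(z)}`** (explicit form, any temperatures): for `q ≥ 1`, `0 < θ < 1/max(T_L, T_R)`,
`s ∈ [0, 1]`, every level `m`, starting point `z` and direction `δ`,
`E ‖D_Ξ X_s^{m}(z, R_m B, Ξ_m B)[δ]‖^q ≤ (max(|c_L|,|c_R|) skelAbsSum δ)^q ·
exp(q A₀ + q² A₁²/(4θ) + θγ(T_L+T_R)) · exp(θ H(z))`. [folklore]
[cite: CuneoEckmannHairerReyBellet2018, §3 eq. (3.4)] -/
theorem lintegral_rpow_norm_fderiv_skelFlowMapAt_le {q : ℝ} (hq : 1 ≤ q) {θ : ℝ} (hθ : 0 < θ)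
    (hθ' : θ < 1 / max T_L T_R) {s : ℝ} (hs : s ∈ Icc (0 : ℝ) 1) (m : ℕ) (z : PhaseSpace N)
    (δ : PairSkeleton m) :
    ∫⁻ wp, ENNReal.ofReal ‖fderiv ℝ
        (skelFlowMapAt ω₂ lam β γ N T_L T_R s m z (pairRem m wp)) (pairSkel m wp) δ‖ ^ q
        ∂wienerPair ≤
      ENNReal.ofReal ((max |ampL ω₂ lam β γ T_L| |ampR ω₂ lam β γ T_R| * skelAbsSum δ) ^ q *
        (Real.exp (q * driftA₀ ω₂ γ N + q ^ 2 * driftA₁ lam β N ^ 2 / (4 * θ) +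
            θ * γ * (T_L + T_R)) *
          Real.exp (θ * (pinnedChain ω₂ lam β γ).hamiltonian N z))) := by
  refine lintegral_rpow_le_of_le_mul_exp_integral hω hl hβ hγ hN hTL hTR hq hθ hθ' hs z
    (driftA₀_nonneg hω.le hγ N) (mul_nonneg (le_max_of_le_left (abs_nonneg _)) (skelAbsSum_nonneg δ))
    (fun wp => norm_nonneg _) fun wp => ?_
  have h := norm_fderiv_skelFlowMapAt_le hω hl hβ hγ N T_L T_R hs m z (pairRem m wp)
    (pairSkel m wp) δ
  have hI : ∫ u in (0 : ℝ)..s, (driftA₀ ω₂ γ N + driftA₁ lam β N *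
        √((pinnedChain ω₂ lam β γ).hamiltonian N
          (skelFlowMapAt ω₂ lam β γ N T_L T_R u m z (pairRem m wp) (pairSkel m wp)))) =
      ∫ u in (0 : ℝ)..s, (driftA₀ ω₂ γ N + driftA₁ lam β N *
        √((pinnedChain ω₂ lam β γ).hamiltonian N
          ((pinnedChain ω₂ lam β γ).solMap N T_L T_R u z (pairPath wp)))) := by
    refine intervalIntegral.integral_congr fun u hu => ?_
    have hu' : u ∈ Icc (0 : ℝ) 1 := by
      rw [uIcc_of_le hs.1] at hu
      exact ⟨hu.1, hu.2.trans hs.2⟩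
    simp only [pinnedChain_solMap_eq_skelFlowMapAt hω hl hβ hγ N T_L T_R hu' m z wp]
  rw [hI] at h
  exact h

end Moment

/-! ## 5. (JMˣ)₁ -/

/-- **(JMˣ)₁ `SkeletonJacobianMoments`** (support leaf of part T; PROVED below,
`skeletonJacobianMoments`).  Moments of the first skeleton variation of the flow along the Brownian
path: for positive parameters, `T > 0`, `N ≥ 1`, `q ≥ 1`, `ε > 0` there is `C` such that for all
bath temperatures `T_L, T_R ∈ [T/2, 2T]`, all `0 ≤ s ≤ 1`, every LEVEL `m`, every starting point
`z` and every skeleton direction `δ`,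
`E ‖D_Ξ X_s^{m}(z, R_m B, Ξ_m B)[δ]‖^q ≤ (C · skelAbsSum δ · e^{εH(z)})^q`
(`skelFlowMapAt`, `pairRem`, `pairSkel`; the derivative exists for every path,
`contDiff_skelFlowMapAt`).  For a basis direction `skelAbsSum = 1`: the bound is uniform in the
level and the index. [route statement · this cell; NOT a literature fact] (after CuneoEckmannHairerReyBellet2018, §3 eq. (3.4)) [route leaf · named hypothesis of this cell, NOT filed as a literature fact] -/
def SkeletonJacobianMoments : Prop :=
  ∀ ω₂ lam β γ : ℝ, 0 < ω₂ → 0 < lam → 0 < β → 0 < γ →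
    ∀ T : ℝ, 0 < T → ∀ N : ℕ, 0 < N → ∀ q ε : ℝ, 1 ≤ q → 0 < ε → ∃ C : ℝ,
      ∀ T_L T_R : ℝ, T / 2 ≤ T_L → T_L ≤ 2 * T → T / 2 ≤ T_R → T_R ≤ 2 * T →
        ∀ s : ℝ, 0 ≤ s → s ≤ 1 → ∀ (m : ℕ) (z : PhaseSpace N) (δ : PairSkeleton m),
          ∫⁻ wp, ENNReal.ofReal ‖fderiv ℝ
              (skelFlowMapAt ω₂ lam β γ N T_L T_R s m z (pairRem m wp)) (pairSkel m wp) δ‖ ^ q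
              ∂wienerPair ≤
            ENNReal.ofReal ((C * skelAbsSum δ *
              Real.exp (ε * (pinnedChain ω₂ lam β γ).hamiltonian N z)) ^ q)

/-- **(JMˣ)₁ — PROVED** (`θ = min ε (1/(4T))`,
`C = √(4γT) · exp(A₀ + q A₁²/(4θ) + 4θγT)`). [folklore]
[cite: CuneoEckmannHairerReyBellet2018, §3 eq. (3.4)] -/
theorem skeletonJacobianMoments : SkeletonJacobianMoments := by
  intro ω₂ lam β γ hω hl hβ hγ T hT N hN q ε hq hε
  have hq0 : 0 ≤ q := zero_le_one.trans hq
  -- the exponential-moment parameter, valid on the whole temperature window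
  set θ : ℝ := min ε (1 / (4 * T)) with hθdef
  have hθ : 0 < θ := lt_min hε (by positivity)
  have hθε : θ ≤ ε := min_le_left _ _
  have hθT : θ ≤ 1 / (4 * T) := min_le_right _ _
  clear_value θ
  set A₀ := driftA₀ ω₂ γ N with hA₀
  set A₁ := driftA₁ lam β N with hA₁
  refine ⟨Real.sqrt (4 * γ * T) * Real.exp (A₀ + q * A₁ ^ 2 / (4 * θ) + 4 * θ * γ * T), ?_⟩
  intro T_L T_R hTL1 hTL2 hTR1 hTR2 s hs0 hs1 m z δ
  have hTL : 0 < T_L := by linarith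
  have hTR : 0 < T_R := by linarith
  have hθ' : θ < 1 / max T_L T_R := by
    have hmax : max T_L T_R ≤ 2 * T := max_le hTL2 hTR2
    have h1 : 1 / (2 * T) ≤ 1 / max T_L T_R :=
      one_div_le_one_div_of_le (lt_max_of_lt_left hTL) hmax
    have h2 : 1 / (4 * T) < 1 / (2 * T) := one_div_lt_one_div_of_lt (by positivity) (by linarith)
    linarith
  have hmain := lintegral_rpow_norm_fderiv_skelFlowMapAt_le hω hl.le hβ.le hγ.le hN hTL hTR hq
    hθ hθ' ⟨hs0, hs1⟩ m z δ
  refine hmain.trans (ENNReal.ofReal_le_ofReal ?_)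
  rw [← hA₀, ← hA₁]
  have hH0 : 0 ≤ (pinnedChain ω₂ lam β γ).hamiltonian N z :=
    pinnedChain_hamiltonian_nonneg hω.le hl.le hβ.le γ N z
  set H := (pinnedChain ω₂ lam β γ).hamiltonian N z with hH
  have hS := skelAbsSum_nonneg δ
  set S := skelAbsSum δ with hSdef
  -- the amplitudes on the window
  have hamp : ∀ T' : ℝ, T' ≤ 2 * T →
      |Real.sqrt (2 * (pinnedChain ω₂ lam β γ).γ * T')| ≤ Real.sqrt (4 * γ * T) := by
    intro T' hT'
    rw [abs_of_nonneg (Real.sqrt_nonneg _)]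
    refine Real.sqrt_le_sqrt ?_
    have hγ' : (pinnedChain ω₂ lam β γ).γ = γ := rfl
    rw [hγ']
    nlinarith [hγ.le]
  have hmax : max |ampL ω₂ lam β γ T_L| |ampR ω₂ lam β γ T_R| ≤ Real.sqrt (4 * γ * T) := by
    show max |Real.sqrt (2 * (pinnedChain ω₂ lam β γ).γ * T_L)|
      |Real.sqrt (2 * (pinnedChain ω₂ lam β γ).γ * T_R)| ≤ _
    exact max_le (hamp T_L hTL2) (hamp T_R hTR2)
  have hmax0 : 0 ≤ max |ampL ω₂ lam β γ T_L| |ampR ω₂ lam β γ T_R| :=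
    le_max_of_le_left (abs_nonneg _)
  -- the three factors
  have h1 : (max |ampL ω₂ lam β γ T_L| |ampR ω₂ lam β γ T_R| * S) ^ q ≤
      (Real.sqrt (4 * γ * T) * S) ^ q :=
    Real.rpow_le_rpow (mul_nonneg hmax0 hS) (mul_le_mul_of_nonneg_right hmax hS) hq0
  have h2 : Real.exp (q * A₀ + q ^ 2 * A₁ ^ 2 / (4 * θ) + θ * γ * (T_L + T_R)) ≤
      Real.exp (A₀ + q * A₁ ^ 2 / (4 * θ) + 4 * θ * γ * T) ^ q := by
    rw [← Real.exp_mul, Real.exp_le_exp]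
    have h21 : θ * γ * (T_L + T_R) ≤ θ * γ * (4 * T) :=
      mul_le_mul_of_nonneg_left (by linarith) (mul_nonneg hθ.le hγ.le)
    have h22 : θ * γ * (4 * T) ≤ θ * γ * (4 * T) * q :=
      le_mul_of_one_le_right (by positivity) hq
    have h23 : (A₀ + q * A₁ ^ 2 / (4 * θ) + 4 * θ * γ * T) * q =
        q * A₀ + q ^ 2 * A₁ ^ 2 / (4 * θ) + θ * γ * (4 * T) * q := by ring
    linarith
  have h3 : Real.exp (θ * H) ≤ Real.exp (ε * H) ^ q := by
    rw [← Real.exp_mul, Real.exp_le_exp]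
    have h31 : θ * H ≤ ε * H := mul_le_mul_of_nonneg_right hθε hH0
    have h32 : ε * H ≤ ε * H * q := le_mul_of_one_le_right (by positivity) hq
    linarith
  have hE1 : 0 ≤ Real.exp (A₀ + q * A₁ ^ 2 / (4 * θ) + 4 * θ * γ * T) ^ q :=
    Real.rpow_nonneg (Real.exp_pos _).le q
  have hE2 : 0 ≤ Real.exp (ε * H) ^ q := Real.rpow_nonneg (Real.exp_pos _).le q
  calc (max |ampL ω₂ lam β γ T_L| |ampR ω₂ lam β γ T_R| * S) ^ q *
        (Real.exp (q * A₀ + q ^ 2 * A₁ ^ 2 / (4 * θ) + θ * γ * (T_L + T_R)) * Real.exp (θ * H))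
      ≤ (Real.sqrt (4 * γ * T) * S) ^ q *
          (Real.exp (A₀ + q * A₁ ^ 2 / (4 * θ) + 4 * θ * γ * T) ^ q * Real.exp (ε * H) ^ q) :=
        mul_le_mul h1 (mul_le_mul h2 h3 (Real.exp_pos _).le hE1) (by positivity)
          (Real.rpow_nonneg (mul_nonneg (Real.sqrt_nonneg _) hS) q)
    _ = (Real.sqrt (4 * γ * T) * Real.exp (A₀ + q * A₁ ^ 2 / (4 * θ) + 4 * θ * γ * T) * S *
          Real.exp (ε * H)) ^ q := by
        rw [← Real.mul_rpow (Real.exp_pos _).le (Real.exp_pos _).le,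
          ← Real.mul_rpow (mul_nonneg (Real.sqrt_nonneg _) hS)
            (mul_nonneg (Real.exp_pos _).le (Real.exp_pos _).le)]
        congr 1
        ring

end Summit.AtomisticToContinuum.FouriersLaw.Theorems.ExtensiveSnapshotIrreversibility.EnergyWindow

end
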